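import Summits.BirchSwinnertonDyer.BirchSwinnertonDyer.Theorems.PrintCFramBottomClassIndexLawFiveLeKrizLiBindersKroneckerOdd
import Summits.BirchSwinnertonDyer.BirchSwinnertonDyer.Theorems.PrintCFramBottomClassIndexLawFiveLeKrizLiBindersKroneckerEven
import Summits.BirchSwinnertonDyer.BirchSwinnertonDyer.Theorems.PrintCFramBottomClassIndexLawFiveLeKrizLiBindersCharacters
import Summits.BirchSwinnertonDyer.BirchSwinnertonDyer.Theorems.PrintCFramBottomClassIndexLawFiveLeEisensteinTraceFormTwist
import Summits.BirchSwinnertonDyer.BirchSwinnertonDyer.Theorems.PrintCFramBottomClassIndexLawFiveLeTransferCoprimeTwist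
import Summits.BirchSwinnertonDyer.Rank1Residual.AdditivePotMult.QuadraticBaseChangeOddTamagawaUnits
import Summits.BirchSwinnertonDyer.Rank1Residual.AdditivePotMult.QuadraticTwistTamagawaGood
import Literature.NumberTheory.EllipticCurves.QuadraticTwistKroneckerEvenLFunctionProofs
import Literature.NumberTheory.EllipticCurves.QuadraticTwistJInvariantProofs
import Literature.NumberTheory.EllipticCurves.ComplexMultiplicationLFunctionIsogenyHoldsProofs
import Literature.NumberTheory.EllipticCurves.BSDSelmerCMPConverseMaximalOrderProofs
import Literature.NumberTheory.QuadraticFields.FundamentalDiscriminant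
import HarnessLib

/-!
# Crux `PrintCFram.BottomClassIndexLawFiveLe` (stmt-BirchSwinnertonDyer-20372), line `eisenstein-resource-bdp-line`:
# the KRIZ–LI BINDERS CLASS-LEVEL, part T — the ENGINE (character data ⟹ the five Kriz–Li binders `ψ` primitive, `hss`,
# (1), (3)) and the TWIST LAYER (a coprime twisting presentation `W ∼ W₁ ≅ E^{(e)}` ⟹ the character data)
# (cell `bsd-print-cfram`, width seat `bsd-line-cfram-p1-w3` g2; THEOREMS ONLY, `--supports` 20372; BSD is not proved by any of this)

HONEST FRAMING. Nothing here is a statement about BSD. The «(regular) Kriz–Li datum» of the line's skeleton (v6/v7) and of the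
LEAD's Kriz–Li-locus theorems carries, besides the Heegner field `K''`, `ε_K`, the Bernoulli hypothesis (4) and the frame,
FIVE binder lines of CHARACTER DATA for `KrizLi2019.thm120_padicLogHeegner_unit_of_bernoulli`: a primitive `ψ`, a Teichmüller
`ω`, the trace form `hss : ∀ ℓ ∤ pN, ‖a_ℓ(W) − (ψ(ℓ) + ψ⁻¹(ℓ)ω(ℓ))‖ < 1`, (1) `ψ(p) ≠ 1 ∧ (ψ⁻¹ω)(p) ≠ 1`, (3) at the additive
`ℓ ≠ p`. This file proves:

* §1 `hasGoodReductionAt_quadraticTwist_of_emod_four_any` / `_of_odd_any` — good reduction of the unit twist `E^{(d)}` at a good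
  place of `E` (`d ≡ 1 (mod 4)` any place, resp. odd place), WITHOUT the global-minimality hypothesis of the tree's
  `AdditivePotMult` lemmas (pass to a global minimal model, `quadraticTwist_smul`, `hasGoodReductionAt_smul_iff`).
* §2 **`krizLiBinders_of_data`** (the ENGINE, any odd prime `p`, any `W/ℚ`): from a primitive quadratic `χ` mod `m`, `(m,p) = 1`,
  with integer values `ε` at the primes, an exponent `2 ≤ k ≤ p − 2`, the trace form
  `a_ℓ(W) ≡ ε(ℓ)(ℓ^k + ℓ^{p−k}) (mod p)` at every prime `ℓ ≠ p`, and «`W` good at every prime `ℓ ≠ p` not dividing `m`»: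
  `ψ := χ↑·(ω^k)↑` is primitive of conductor `p·m` and satisfies `hss`, (1), (3) VERBATIM as the named fact binds them.
* §3 **`exists_krizLiData_of_coprime_twist`** (the TWIST LAYER): if `W ∼ W₁` (isogenous over `ℚ`), `C • W₁ = E^{(e)}` with `e`
  squarefree, `p ∤ e`, and the base `E` is good away from `p` with trace form `a_ℓ(E) ≡ ℓ^{k₁} + ℓ^{k₂}`, then the character
  data exist: `χ = (· | |e|)` mod `|e|` if `e ≡ 1 (mod 4)` (part K-odd, `LFunction_quadraticTwist_apply_of_emod_four_eq_one`),
  `χ = [· odd]·(e | ·)` mod `4|e|` otherwise (part K-even, `LFunction_quadraticTwist_apply_of_four_dvd_discr`); the trace form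
  and good reduction transfer along the isogeny (`IsIsogenous.LFunction_eq`, `IsIsogenous.hasGoodReductionAtPrime_iff`).

Part W (`…KrizLiBinders.lean`) feeds §3 with the seven leaf classes and packages the binder block. beyond-print theorem: NO.
References: [KrizLi2019] Thm. 1.20, Rem. 1.21, §2; [SilvermanAEC2009] VII.5 Prop. 5.1, X.2 Ex. 10.16, X.5 Prop. 5.4;
[Mazur1978] Prop. 6.3 (1); [Cox2013] §1.C Lemma 1.14.
-/

noncomputable section

-- summit-side namespace `Summit.BirchSwinnertonDyer.BirchSwinnertonDyer.…` (single-conjunct summit, D-0017 layout)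
set_option linter.dupNamespace false

open scoped Classical NumberTheorySymbols
open NumberField IsDedekindDomain IsDedekindDomain.HeightOneSpectrum WeierstrassCurve DirichletCharacter
open Literature.NumberTheory.EllipticCurves Literature.NumberTheory.EllipticCurves.KrizLi2019
open Literature.NumberTheory.EllipticCurves.Rank1Residual Literature.NumberTheory.QuadraticFields
open Summit.BirchSwinnertonDyer.Rank1Residual Summit.BirchSwinnertonDyer.Rank1Residual.X12.O11.RouteU

namespace Summit.BirchSwinnertonDyer.BirchSwinnertonDyer.Theorems.PrintCFram.KrizLiBinders

variable {p : ℕ} [hp : Fact p.Prime]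

/-! ## §1 Good reduction of unit twists at good places, without global minimality of the base -/

/-- **`E` good at `v`, `d ≡ 1 (mod 4)`, `ℓ_v ∤ d` ⟹ `E^{(d)}` good at `v`** (any residue characteristic), for ANY model `E`:
pass to a global minimal model `C • E` (Silverman VIII.8.3), apply the tree's `AdditivePotMult.hasGoodReductionAt_quadraticTwist_of_emod_four`,
and come back along `(C • E)^{(d)} = C' • E^{(d)}` (`quadraticTwist_smul`). [cite: SilvermanAEC2009, VII.5 Prop. 5.1(a) and VIII.8 Cor. 8.3] -/
theorem hasGoodReductionAt_quadraticTwist_of_emod_four_any (E : WeierstrassCurve ℚ) [E.IsElliptic]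
    (v : HeightOneSpectrum (𝓞 ℚ)) {d : ℤ} (hd4 : d % 4 = 1)
    (hd : ¬ ((Rat.HeightOneSpectrum.primesEquiv v : ℕ) : ℤ) ∣ d) (hgood : E.HasGoodReductionAt v) :
    (E.quadraticTwist (d : ℚ)).HasGoodReductionAt v := by
  obtain ⟨C, hC⟩ := hasGlobalMinimalModel_rat_holds E
  haveI := hC
  have h1 : (C • E).HasGoodReductionAt v := (hasGoodReductionAt_smul_iff_holds v E C).mpr hgood
  have h2 := AdditivePotMult.hasGoodReductionAt_quadraticTwist_of_emod_four (C • E) v hd4 hd h1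
  rw [quadraticTwist_smul] at h2
  exact (hasGoodReductionAt_smul_iff_holds v _ _).mp h2

/-- **`E` good at an ODD place `v`, `ℓ_v ∤ d` ⟹ `E^{(d)}` good at `v`**, for ANY model `E` and any `d`.
[cite: SilvermanAEC2009, VII.5 Prop. 5.1(a) and VIII.8 Cor. 8.3] -/
theorem hasGoodReductionAt_quadraticTwist_of_odd_any (E : WeierstrassCurve ℚ) [E.IsElliptic]
    (v : HeightOneSpectrum (𝓞 ℚ)) (hv2 : (Rat.HeightOneSpectrum.primesEquiv v : ℕ) ≠ 2) {d : ℤ}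
    (hd : ¬ ((Rat.HeightOneSpectrum.primesEquiv v : ℕ) : ℤ) ∣ d) (hgood : E.HasGoodReductionAt v) :
    (E.quadraticTwist (d : ℚ)).HasGoodReductionAt v := by
  obtain ⟨C, hC⟩ := hasGlobalMinimalModel_rat_holds E
  haveI := hC
  have h1 : (C • E).HasGoodReductionAt v := (hasGoodReductionAt_smul_iff_holds v E C).mpr hgood
  have h2 := (AdditivePotMult.hasGoodReductionAt_quadraticTwist_of_not_dvd (C • E) v hv2 hd h1).2
  rw [quadraticTwist_smul] at h2
  exact (hasGoodReductionAt_smul_iff_holds v _ _).mp h2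

omit hp in
/-- From the prime-indexed `HasGoodReductionAtPrime` away from `p` to the place-indexed `HasGoodReductionAt` at every place
not over `p`. [cite: SilvermanAEC2009, VII.5 Prop. 5.1(a)] -/
theorem hasGoodReductionAt_of_forall_prime_ne (E : WeierstrassCurve ℚ)
    (hgood : ∀ (q : ℕ) [Fact q.Prime], q ≠ p → E.HasGoodReductionAtPrime q)
    (v : HeightOneSpectrum (𝓞 ℚ)) (hv : (Rat.HeightOneSpectrum.primesEquiv v : ℕ) ≠ p) : E.HasGoodReductionAt v := by
  haveI := Fact.mk (Rat.HeightOneSpectrum.primesEquiv v).2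
  exact (hasGoodReductionAtPrime_iff_hasGoodReductionAt_ringOfIntegers v E).mp (hgood _ hv)

/-! ## §2 The ENGINE: character data ⟹ the five Kriz–Li binders -/

/-- **THE ENGINE.** Let `p` be an odd prime, `W/ℚ` any Weierstrass curve, `χ` a PRIMITIVE QUADRATIC `ℚ_p`-valued Dirichlet
character mod `m` with `(m, p) = 1` and integer values `ε(ℓ)` at the primes `ℓ ≠ p`, `k` an exponent with `2 ≤ k ≤ p − 2`, and
assume the TRACE FORM `a_ℓ(W) ≡ ε(ℓ)·(ℓ^k + ℓ^{p−k}) (mod p)` at every prime `ℓ ≠ p` and that `W` has good reduction at every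
prime `ℓ ≠ p` not dividing `m`. Then for every Teichmüller `ω`, the character `ψ := χ↑·(ω^k)↑` of level `p·m` is PRIMITIVE and
satisfies the three Kriz–Li binders VERBATIM: `hss` (`∀ ℓ ∤ p·N_W`), (1) `ψ(p) ≠ 1 ∧ (ψ⁻¹ω)(p) ≠ 1`, (3) at every additive
`ℓ ≠ p`: `ψ(ℓ) ≠ 1 ∧ (ψ⁻¹ω)(ℓ) ≠ 1` (such `ℓ` divide `m`, where both primitive values vanish).
[cite: KrizLi2019, Thm. 1.20 (pp. 7–8), Rem. 1.21, §2 (pp. 11–12)] -/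
theorem krizLiBinders_of_data (hp2 : p ≠ 2) (W : WeierstrassCurve ℚ) {m : ℕ} [NeZero m]
    (χ : DirichletCharacter ℚ_[p] m) (hχ : χ.IsPrimitive) (hχq : χ.IsQuadratic) (hmp : m.Coprime p)
    (ε : ℕ → ℤ) (hε : ∀ ℓ : ℕ, ℓ.Prime → ℓ ≠ p → χ (ℓ : ZMod m) = (ε ℓ : ℚ_[p]))
    {k : ℕ} (hk2 : 2 ≤ k) (hkp : k ≤ p - 2)
    (htr : ∀ ℓ : ℕ, ℓ.Prime → ℓ ≠ p →
      ((W.LFunction ℓ : ℤ) : ZMod p) = (ε ℓ : ZMod p) * ((ℓ : ZMod p) ^ k + (ℓ : ZMod p) ^ (p - k)))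
    (hgoodW : ∀ ℓ : ℕ, (hℓ : ℓ.Prime) → ℓ ≠ p → ¬ ℓ ∣ m → (haveI := Fact.mk hℓ; W.HasGoodReductionAtPrime ℓ))
    (ω : DirichletCharacter ℚ_[p] p) (hω : IsTeichmullerCharacter ω) :
    (changeLevel (dvd_mul_left m p) χ * changeLevel (dvd_mul_right p m) (ω ^ k) :
        DirichletCharacter ℚ_[p] (p * m)).IsPrimitive ∧
    (∀ ℓ : ℕ, ℓ.Prime → ¬ (ℓ ∣ p * W.conductorNorm ℤ) →
      ‖((W.LFunction ℓ : ℤ) : ℚ_[p]) -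
        ((changeLevel (dvd_mul_left m p) χ * changeLevel (dvd_mul_right p m) (ω ^ k) :
            DirichletCharacter ℚ_[p] (p * m)) (ℓ : ZMod (p * m)) +
          (changeLevel (dvd_mul_left m p) χ * changeLevel (dvd_mul_right p m) (ω ^ k) :
            DirichletCharacter ℚ_[p] (p * m))⁻¹ (ℓ : ZMod (p * m)) * ω (ℓ : ZMod p))‖ < 1) ∧
    ((changeLevel (dvd_mul_left m p) χ * changeLevel (dvd_mul_right p m) (ω ^ k) :
        DirichletCharacter ℚ_[p] (p * m)) (p : ZMod (p * m)) ≠ 1 ∧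
      primVal (invMulOmega (changeLevel (dvd_mul_left m p) χ * changeLevel (dvd_mul_right p m) (ω ^ k)) ω) p ≠ 1) ∧
    (∀ ℓ : ℕ, (hℓ : ℓ.Prime) → ℓ ≠ p →
      (haveI := Fact.mk hℓ; ¬ W.HasGoodReductionAtPrime ℓ ∧ ¬ W.HasMultiplicativeReductionAtPrime ℓ) →
      (changeLevel (dvd_mul_left m p) χ * changeLevel (dvd_mul_right p m) (ω ^ k) :
          DirichletCharacter ℚ_[p] (p * m)) (ℓ : ZMod (p * m)) ≠ 1 ∧
        primVal (invMulOmega (changeLevel (dvd_mul_left m p) χ * changeLevel (dvd_mul_right p m) (ω ^ k)) ω) ℓ ≠ 1) := by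
  set ψ : DirichletCharacter ℚ_[p] (p * m) :=
    changeLevel (dvd_mul_left m p) χ * changeLevel (dvd_mul_right p m) (ω ^ k) with hψdef
  have hpp : p.Prime := hp.out
  obtain ⟨hωk, hωk1⟩ := teichmuller_pow_ne_one_and hω hk2 hkp
  have hk0 : k ≠ 0 := by omega
  have hkp' : k ≤ p - 1 := by omega
  -- `p` and the divisors of `m` are not coprime to `p m`
  have hncp : ∀ {a : ℕ}, 1 < a → (a ∣ p ∨ a ∣ m) → ¬ a.Coprime (p * m) := by
    intro a ha hdv hcop
    rcases hdv with h | h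
    · exact ha.ne' (Nat.Coprime.eq_one_of_dvd (hcop.coprime_dvd_right (dvd_mul_right p m)) h)
    · exact ha.ne' (Nat.Coprime.eq_one_of_dvd (hcop.coprime_dvd_right (dvd_mul_left m p)) h)
  refine ⟨psi_isPrimitive ω χ k hmp hχ hωk, ?_, ?_, ?_⟩
  · -- hss
    refine EisensteinTraceForm.hss_of_traceForm_prime W p k (p - k) ψ ω hω ε (fun ℓ hℓ hℓN => ?_)
      (fun ℓ hℓ hℓN => ?_)
    · have hne : ℓ ≠ p := by rintro rfl; exact hℓN (dvd_mul_right ℓ _)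
      exact htr ℓ hℓ hne
    · have hne : ℓ ≠ p := by rintro rfl; exact hℓN (dvd_mul_right ℓ _)
      have hpl : ¬ p ∣ ℓ := fun h => hne ((Nat.prime_dvd_prime_iff_eq hpp hℓ).mp h).symm
      rw [hψdef, psi_traceIdentity ω χ k hχq hk0 hkp' ℓ hpl, hε ℓ hℓ hne]
  · -- (1)
    have hnc : ¬ p.Coprime (p * m) := hncp hpp.one_lt (Or.inl dvd_rfl)
    exact ⟨psi_apply_natCast_ne_one ψ hnc, primVal_invMulOmega_psi_ne_one ω χ k hmp hχ hωk1 hnc⟩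
  · -- (3): an additive `ℓ ≠ p` divides `m`
    intro ℓ hℓ hne hadd
    have hℓm : ℓ ∣ m := by
      by_contra h
      exact hadd.1 (hgoodW ℓ hℓ hne h)
    have hnc : ¬ ℓ.Coprime (p * m) := hncp hℓ.one_lt (Or.inr hℓm)
    exact ⟨psi_apply_natCast_ne_one ψ hnc, primVal_invMulOmega_psi_ne_one ω χ k hmp hχ hωk1 hnc⟩

/-! ## §3 The TWIST LAYER: a coprime twisting presentation ⟹ the character data -/

/-- **Character data from a coprime twisting presentation.** Let `p` be an odd prime, `E/ℚ` elliptic with good reduction at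
every prime `≠ p` and trace form `a_ℓ(E) ≡ ℓ^{k₁} + ℓ^{k₂} (mod p)` at every prime `ℓ ≠ p`; let `W ∼ W₁` be `ℚ`-isogenous
elliptic curves with `C • W₁ = E^{(e)}`, `e` squarefree, `p ∤ e`. Then there are `m` coprime to `p`, a PRIMITIVE QUADRATIC
`ℚ_p`-valued character `χ` mod `m` with integer values `ε` (`χ(a) = ε(a)` for all `a : ℕ`), `χ(−1) = ±1`, such that
`a_ℓ(W) ≡ ε(ℓ)(ℓ^{k₁} + ℓ^{k₂}) (mod p)` at every prime `ℓ ≠ p` and `W` is good at every prime `ℓ ≠ p`, `ℓ ∤ m`: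
`(m, χ) = (|e|, (·| |e|))` if `e ≡ 1 (mod 4)`, `(4|e|, [· odd]·(e|·))` if `e ≡ 2, 3 (mod 4)`.
[cite: SilvermanAEC2009, X.2 and Exercise 10.16, VII.5 Prop. 5.1(a)] [cite: Cox2013, §1.C Lemma 1.14] [cite: KrizLi2019, §2 (p. 12)] -/
theorem exists_krizLiData_of_coprime_twist (hp2 : p ≠ 2) (E : WeierstrassCurve ℚ) [E.IsElliptic] (k₁ k₂ : ℕ)
    (hgood : ∀ (q : ℕ) [Fact q.Prime], q ≠ p → E.HasGoodReductionAtPrime q)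
    (hbase : ∀ (ℓ : ℕ) [Fact ℓ.Prime], ℓ ≠ p → (E.LFunction ℓ : ZMod p) = (ℓ : ZMod p) ^ k₁ + (ℓ : ZMod p) ^ k₂)
    (W W₁ : WeierstrassCurve ℚ) [W.IsElliptic] [W₁.IsElliptic] (hiso : IsIsogenous W W₁)
    {e : ℤ} (hsq : Squarefree e) (hpe : ¬ (p : ℤ) ∣ e)
    (hW₁ : ∃ C : VariableChange ℚ, C • W₁ = E.quadraticTwist (e : ℚ)) :
    ∃ (m : ℕ) (_ : NeZero m) (χ : DirichletCharacter ℚ_[p] m) (ε : ℕ → ℤ),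
      m.Coprime p ∧ χ.IsPrimitive ∧ χ.IsQuadratic ∧ (∀ a : ℕ, χ (a : ZMod m) = (ε a : ℚ_[p])) ∧
      (χ (-1) = 1 ∨ χ (-1) = -1) ∧
      (∀ ℓ : ℕ, ℓ.Prime → ℓ ≠ p →
        ((W.LFunction ℓ : ℤ) : ZMod p) = (ε ℓ : ZMod p) * ((ℓ : ZMod p) ^ k₁ + (ℓ : ZMod p) ^ k₂)) ∧
      (∀ ℓ : ℕ, (hℓ : ℓ.Prime) → ℓ ≠ p → ¬ ℓ ∣ m → (haveI := Fact.mk hℓ; W.HasGoodReductionAtPrime ℓ)) := by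
  have hpp : p.Prime := hp.out
  have he0 : e ≠ 0 := hsq.ne_zero
  have heQ : (e : ℚ) ≠ 0 := by exact_mod_cast he0
  obtain ⟨C, hC⟩ := hW₁
  have hLW : W.LFunction = W₁.LFunction := hiso.LFunction_eq
  haveI := E.isElliptic_quadraticTwist heQ
  have hpe' : ¬ p ∣ e.natAbs := fun h => hpe (Int.natCast_dvd.mpr h)
  have hcopE : e.natAbs.Coprime p := ((Nat.Prime.coprime_iff_not_dvd hpp).mpr hpe').symm
  have hp4 : ¬ p ∣ 4 := fun h => hp2 ((Nat.prime_dvd_prime_iff_eq hpp Nat.prime_two).mp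
    (hpp.dvd_of_dvd_pow (show p ∣ 2 ^ 2 by simpa using h)))
  have hcop4 : (4 : ℕ).Coprime p := ((Nat.Prime.coprime_iff_not_dvd hpp).mpr hp4).symm
  -- `χ(−1) = ±1` for a quadratic character (−1 is a unit)
  have hsign : ∀ {n : ℕ} (θ : DirichletCharacter ℚ_[p] n), θ.IsQuadratic → θ (-1) = 1 ∨ θ (-1) = -1 := by
    intro n θ hθ
    rcases hθ (-1) with h | h | h
    · exact absurd h (isUnit_one.neg.map θ).ne_zero
    · exact Or.inl h
    · exact Or.inr h
  -- good reduction of `W` at a prime `ℓ ≠ p` from good reduction of `E^{(e)}` at the place over `ℓ`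
  have hgoodW : ∀ ℓ : ℕ, (hℓ : ℓ.Prime) → ℓ ≠ p →
      (∀ v : HeightOneSpectrum (𝓞 ℚ), (Rat.HeightOneSpectrum.primesEquiv v : ℕ) = ℓ →
        (E.quadraticTwist (e : ℚ)).HasGoodReductionAt v) →
      (haveI := Fact.mk hℓ; W.HasGoodReductionAtPrime ℓ) := by
    intro ℓ hℓ hne htw
    haveI := Fact.mk hℓ
    obtain ⟨v, rfl⟩ : ∃ v : HeightOneSpectrum (𝓞 ℚ), (Rat.HeightOneSpectrum.primesEquiv v : ℕ) = ℓ :=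
      ⟨Rat.HeightOneSpectrum.primesEquiv.symm ⟨ℓ, hℓ⟩, by rw [Equiv.apply_symm_apply]⟩
    have h1 : (C • W₁).HasGoodReductionAt v := by rw [hC]; exact htw v rfl
    have h2 : W₁.HasGoodReductionAt v := (hasGoodReductionAt_smul_iff_holds v W₁ C).mp h1
    have h3 : W₁.HasGoodReductionAtPrime (Rat.HeightOneSpectrum.primesEquiv v : ℕ) :=
      (hasGoodReductionAtPrime_iff_hasGoodReductionAt_ringOfIntegers v W₁).mpr h2
    exact (hiso.hasGoodReductionAtPrime_iff _).mpr h3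
  by_cases he4 : e % 4 = 1
  · /- ODD discriminant `D = e`: `χ = (· | |e|)` mod `m = |e|` -/
    haveI : NeZero e.natAbs := ⟨Int.natAbs_ne_zero.mpr he0⟩
    obtain ⟨χ, hχ⟩ := exists_jacobiCharPadic (p := p) e.natAbs
    have hodd : Odd e.natAbs := by
      rw [Int.natAbs_odd, Int.odd_iff]; omega
    have hsqn : Squarefree e.natAbs := Int.squarefree_natAbs.mpr hsq
    refine ⟨e.natAbs, inferInstance, χ, fun a => J((a : ℤ) | e.natAbs), ?_, isPrimitive_of_forall_eq_jacobiSym hχ hodd hsqn,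
      isQuadratic_of_forall_eq_jacobiSym hχ, hχ, hsign χ (isQuadratic_of_forall_eq_jacobiSym hχ), ?_, ?_⟩
    · -- `(|e|, p) = 1`
      exact hcopE
    · -- trace form at every `ℓ ≠ p`
      intro ℓ hℓ hne
      haveI := Fact.mk hℓ
      rw [hLW]
      exact EisensteinTraceForm.lFunction_twist_mod_of_traceForm E p k₁ k₂ hgood hbase W₁ he4 hsq hpe ⟨C, hC⟩ ℓ hne
    · -- good reduction of `W` at `ℓ ≠ p`, `ℓ ∤ |e|`
      intro ℓ hℓ hne hℓm
      refine hgoodW ℓ hℓ hne fun v hv => ?_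
      refine hasGoodReductionAt_quadraticTwist_of_emod_four_any E v he4 ?_
        (hasGoodReductionAt_of_forall_prime_ne E hgood v (by rw [hv]; exact hne))
      rw [hv]
      exact fun h => hℓm (Int.natCast_dvd.mp h)
  · /- EVEN discriminant `D = 4e` (`e ≡ 2, 3 (mod 4)`): `χ = [· odd]·(e | ·)` mod `m = 4|e|` -/
    have he4' : e % 4 = 2 ∨ e % 4 = 3 := by
      have h0 : e % 4 ≠ 0 := by
        intro h0
        have h4 : (2 : ℤ) * 2 ∣ e := by omega
        have := hsq 2 h4
        rcases Int.isUnit_iff.mp this with h | h <;> omega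
      omega
    haveI hm0 : NeZero (4 * e.natAbs) := ⟨Nat.mul_ne_zero (by norm_num) (Int.natAbs_ne_zero.mpr he0)⟩
    obtain ⟨χ, hχ⟩ := exists_kroneckerFourPadic (p := p) e he0 (rfl : 4 * e.natAbs = 4 * e.natAbs)
    have hχq := isQuadratic_of_forall_eq_kroneckerFour hχ
    refine ⟨4 * e.natAbs, hm0, χ, fun a => if Even a then (0 : ℤ) else J(e | a), ?_,
      isPrimitive_of_forall_eq_kroneckerFour' rfl he4' hsq hχ, hχq, hχ, hsign χ hχq, ?_, ?_⟩
    · -- `(4|e|, p) = 1`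
      exact Nat.Coprime.mul_left hcop4 hcopE
    · -- trace form at every `ℓ ≠ p`, via a quadratic field of discriminant `4e`
      intro ℓ hℓ hne
      haveI := Fact.mk hℓ
      obtain ⟨M, _, _, hM2, hdM⟩ := Quadratic.exists_numberField_discr_eq (D := 4 * e)
        (Or.inr ⟨dvd_mul_right 4 e, by rw [Int.mul_ediv_cancel_left _ (by norm_num)]; exact he4',
          by rw [Int.mul_ediv_cancel_left _ (by norm_num)]; exact hsq⟩)
      have h4 : 4 ∣ NumberField.discr M := by rw [hdM]; exact dvd_mul_right 4 e
      have hdiv : NumberField.discr M / 4 = e := by rw [hdM, Int.mul_ediv_cancel_left _ (by norm_num)]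
      have hgoodv : ∀ v : HeightOneSpectrum (𝓞 ℚ),
          ((Rat.HeightOneSpectrum.primesEquiv v : ℕ) : ℤ) ∣ NumberField.discr M → E.HasGoodReductionAt v := by
        intro v hvD
        refine hasGoodReductionAt_of_forall_prime_ne E hgood v fun hvp => hpe ?_
        rw [hdM, hvp] at hvD
        exact (Int.Prime.dvd_mul' hpp hvD).resolve_left (fun h => hp4 (by exact_mod_cast h))
      -- `W₁ ≅ E^{(e)} ≅ E^{(4e)} = E^{(d_M)}`
      obtain ⟨C₂, hC₂⟩ := E.exists_variableChange_quadraticTwist_mul_sq (e : ℚ) 2 two_ne_zero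
      have hC₂' : E.quadraticTwist ((4 : ℚ) * e) = C₂ • E.quadraticTwist (e : ℚ) := by
        rw [hC₂]; congr 1; ring
      have h1 : (E.quadraticTwist (NumberField.discr M : ℚ)).LFunction = W.LFunction := by
        rw [hdM]
        push_cast
        rw [hC₂', LFunction_smul, ← hC, LFunction_smul, hLW]
      rw [← h1, E.LFunction_quadraticTwist_apply_of_four_dvd_discr M hM2 h4 hgoodv ℓ, hdiv]
      push_cast
      rw [hbase ℓ hne]
    · -- good reduction of `W` at `ℓ ≠ p`, `ℓ ∤ 4|e|` (so `ℓ` odd, `ℓ ∤ e`)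
      intro ℓ hℓ hne hℓm
      have hℓ2 : ℓ ≠ 2 := by rintro rfl; exact hℓm (dvd_mul_of_dvd_left (by norm_num) _)
      have hℓe : ¬ (ℓ : ℤ) ∣ e := fun h => hℓm (dvd_mul_of_dvd_right (Int.natCast_dvd.mp h) 4)
      refine hgoodW ℓ hℓ hne fun v hv => ?_
      exact hasGoodReductionAt_quadraticTwist_of_odd_any E v (by rw [hv]; exact hℓ2) (by rw [hv]; exact hℓe)
        (hasGoodReductionAt_of_forall_prime_ne E hgood v (by rw [hv]; exact hne))

end Summit.BirchSwinnertonDyer.BirchSwinnertonDyer.Theorems.PrintCFram.KrizLiBinders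

end
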